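import Summits.Ventures.YMGap.RobustBall.LocalSourceOneState
import Summits.Ventures.YMGap.RobustBall.LocalSourceOneStateS
import Summits.Ventures.YMGap.RobustBall.TiltedResponse
import HarnessLib

/-!
# Venture YMGap, track ROBUST-BALL (Y2) — FEYNMAN–HELLMANN ON THE BALL: the response to a local source is
# DIFFERENTIABLE in its strength, the derivative is MINUS A COVARIANCE of the (unique) perturbed state, and at the
# member the susceptibility is EXPONENTIALLY SMALL in the separation at the clustering rate of the currency

HONEST FRAMING. WHAT THIS IS: a venture file (cell `pub-ymgap`, track Y2 ROBUST-BALL, seat rb-p1, theorems only) composing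
`LocalSourceOneState[S].lean` (every DLR state of `W + V` is the tilt `e^{−H^V}μ/μ(e^{−H^V})` of the member's state `μ`) with
the Literature Feynman–Hellmann identity for exponential tilts (`hasDerivAt_integral_tilted_neg_eq_neg_covariance`,
B. Simon 1993 §II.1; all-real-parameter form `hasDerivAt_integral_tilted_of_bounded` in the tool file `TiltedResponse.lean`).  For an adapted bounded member `W` with exactly one DLR state `μ` (tier 1: listed supports
`perturbedYM`; tier 2: link-summable, `perturbedYMS`), a source `V` with finitely many listed terms (`H^V = Σ_{A∈T} V_A`)
and the ONE-PARAMETER FAMILY OF ACTIONS `W + s·V`, `s ∈ ℝ`: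
* `perturbedGibbsMeasures_add_smul_eq_singleton` — for EVERY real `s` the action `W + s·V` has exactly the one DLR state
  `μ_s := μ.tilted (−s H^V)` (so ANY selection `ν s ∈ 𝒢(W + s·V)` is this family);
* `hasDerivAt_integral_of_mem_perturbedGibbsMeasures_add_smul` — for every bounded measurable `F` and every such selection,
  `s ↦ ∫ F dν_s` is DIFFERENTIABLE ON ALL OF `ℝ` with `d/ds ∫ F dν_s = −cov_{ν_s}(F, H^V)` (no phase transition of first
  order in any local coupling; the fluctuation–dissipation theorem, exact);
* `hasDerivAt_integral_at_member` — at `s = 0`: the STATIC SUSCEPTIBILITY `χ_F(V) = d/ds|_{s=0} ⟨F⟩_{W+sV} = −cov_μ(F, H^V)`;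
* the tier-2 twins `perturbedGibbsMeasuresS_add_smul_eq_singleton`, `hasDerivAt_integral_of_mem_perturbedGibbsMeasuresS_add_smul`
  (link-summable members, `perturbedYMS`).
The susceptibility bounds under clustering, the ball forms and the Wilson point with one loop are in `LocalSourceResponseBall.lean`;
real-analyticity in `LocalSourceAnalytic.lean`.
WHAT THIS IS NOT: no claim about sources with infinitely many terms or about `s`-uniformity of the clustering of `ν_s`
(the screening files bound `|ν_s(F) − μ(F)|` uniformly in `s`); lattice, strong coupling (the rows); nothing about the
continuum limit or a Clay-sense mass gap.
-/

noncomputable section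

open MeasureTheory Function Finset Real ProbabilityTheory
open scoped NNReal
open Literature.Probability.LatticeModels
open Literature.MathematicalPhysics.QuantumLattice
open Literature.MathematicalPhysics.QuantumFieldTheory hiding ZdEdge Site

namespace Summit.Ventures.YMGap.RobustBall

variable {d N : ℕ}


/-! ### Tier 1 (listed supports): the one-parameter family `W + s·V` -/

section General

variable {G : Type*} [Group G] [TopologicalSpace G] [IsTopologicalGroup G] [CompactSpace G]
  [MeasurableSpace G] [BorelSpace G] [SecondCountableTopology G] [T2Space G] (ρ : G →* Matrix (Fin N) (Fin N) ℂ)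

omit [Group G] [TopologicalSpace G] [IsTopologicalGroup G] [CompactSpace G] [BorelSpace G] [SecondCountableTopology G]
  [T2Space G] in
/-- The scaled source `s • V` is adapted, bounded and listed by the same support family. -/
theorem smul_source_data {V : Potential (ZdEdge d) G} (hV : V.IsAdapted) (hVb : ∀ X, ∃ C, ∀ U, |V X U| ≤ C)
    {suppV : Finset (ZdEdge d) → Finset (Finset (ZdEdge d))} (hsuppV : V.IsSupportedBy suppV) (s : ℝ) :
    (s • V).IsAdapted ∧ (∀ X, ∃ C, ∀ U, |(s • V) X U| ≤ C) ∧ (s • V).IsSupportedBy suppV := by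
  refine ⟨fun A => ⟨fun U U' h => ?_, ((hV A).2).const_mul s⟩, fun X => ?_, fun Λ A hA h0 => hsuppV Λ A hA fun hV0 => h0 ?_⟩
  · simp only [Pi.smul_apply, smul_eq_mul]
    rw [(hV A).1 h]
  · obtain ⟨C, hC⟩ := hVb X
    refine ⟨|s| * C, fun U => ?_⟩
    simp only [Pi.smul_apply, smul_eq_mul, abs_mul]
    exact mul_le_mul_of_nonneg_left (hC U) (abs_nonneg s)
  · funext U
    simp [Pi.smul_apply, hV0]

omit [Group G] [TopologicalSpace G] [IsTopologicalGroup G] [CompactSpace G] [MeasurableSpace G] [BorelSpace G]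
  [SecondCountableTopology G] [T2Space G] in
/-- The catalogue energy of the scaled source: `Σ_{A∈T} (s•V)_A = s · H^V`. -/
theorem sum_smul_source (V : Potential (ZdEdge d) G) (T : Finset (Finset (ZdEdge d))) (s : ℝ) (U : LGConfig d G) :
    (-∑ A ∈ T, (s • V) A U) = -s * ∑ A ∈ T, V A U := by
  simp only [Pi.smul_apply, smul_eq_mul, ← Finset.mul_sum]
  ring

/-- **FOR EVERY REAL `s`, `W + s·V` HAS EXACTLY THE ONE DLR STATE `μ.tilted (−s H^V)`.** Hypotheses: continuous `ρ`, compact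
second-countable `G`, adapted bounded `W` listed by `supp` with at most one DLR state `μ ∈ 𝒢(W)`, adapted bounded source `V`
listed by `suppV ⊆ T`. -/
theorem perturbedGibbsMeasures_add_smul_eq_singleton (hρ : Continuous ρ) (β : ℝ)
    {W : Potential (ZdEdge d) G} (hW : W.IsAdapted) (hWb : ∀ X, ∃ C, ∀ U, |W X U| ≤ C)
    {supp : Finset (ZdEdge d) → Finset (Finset (ZdEdge d))} (hsupp : W.IsSupportedBy supp)
    {V : Potential (ZdEdge d) G} (hV : V.IsAdapted) (hVb : ∀ X, ∃ C, ∀ U, |V X U| ≤ C)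
    {suppV : Finset (ZdEdge d) → Finset (Finset (ZdEdge d))} (hsuppV : V.IsSupportedBy suppV)
    {T : Finset (Finset (ZdEdge d))} (hT : ∀ Λ, suppV Λ ⊆ T)
    (huniq : (perturbedGibbsMeasures ρ β W supp).Subsingleton)
    {μ : Measure (LGConfig d G)} (hμ : μ ∈ perturbedGibbsMeasures ρ β W supp) (s : ℝ) :
    perturbedGibbsMeasures ρ β (W + s • V) (fun Λ => supp Λ ∪ suppV Λ) =
      {μ.tilted fun U => -s * ∑ A ∈ T, V A U} := by
  obtain ⟨hsV, hsVb, hsVsupp⟩ := smul_source_data hV hVb hsuppV s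
  have hset : perturbedGibbsMeasures ρ β W supp = {μ} :=
    Set.eq_singleton_iff_unique_mem.2 ⟨hμ, fun ν hν => huniq hν hμ⟩
  rw [perturbedGibbsMeasures_add_eq_image ρ hρ β hW hWb hsupp hsV hsVb hsVsupp hT, hset, Set.image_singleton]
  congr 1
  congr 1
  funext U
  exact sum_smul_source V T s U

/-- **FEYNMAN–HELLMANN ON `ℤ^d` (tier 1): THE RESPONSE IS DIFFERENTIABLE IN THE SOURCE STRENGTH, WITH DERIVATIVE MINUS THE
COVARIANCE IN THE PERTURBED STATE.** Under the hypotheses of `perturbedGibbsMeasures_add_smul_eq_singleton`, for EVERY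
selection `ν s ∈ 𝒢(W + s·V)` (`s ∈ ℝ`) and every bounded measurable `F`:
`d/ds ∫ F dν_s |_{s=b} = −cov_{ν_b}(F, H^V)`, `H^V = Σ_{A∈T} V_A`, at every real `b`. -/
theorem hasDerivAt_integral_of_mem_perturbedGibbsMeasures_add_smul (hρ : Continuous ρ) (β : ℝ)
    {W : Potential (ZdEdge d) G} (hW : W.IsAdapted) (hWb : ∀ X, ∃ C, ∀ U, |W X U| ≤ C)
    {supp : Finset (ZdEdge d) → Finset (Finset (ZdEdge d))} (hsupp : W.IsSupportedBy supp)
    {V : Potential (ZdEdge d) G} (hV : V.IsAdapted) (hVb : ∀ X, ∃ C, ∀ U, |V X U| ≤ C)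
    {suppV : Finset (ZdEdge d) → Finset (Finset (ZdEdge d))} (hsuppV : V.IsSupportedBy suppV)
    {T : Finset (Finset (ZdEdge d))} (hT : ∀ Λ, suppV Λ ⊆ T)
    (huniq : (perturbedGibbsMeasures ρ β W supp).Subsingleton)
    {μ : Measure (LGConfig d G)} (hμ : μ ∈ perturbedGibbsMeasures ρ β W supp)
    {ν : ℝ → Measure (LGConfig d G)} (hν : ∀ s, ν s ∈ perturbedGibbsMeasures ρ β (W + s • V) (fun Λ => supp Λ ∪ suppV Λ))
    {F : LGConfig d G → ℝ} (hFm : Measurable F) {C : ℝ} (hFb : ∀ U, |F U| ≤ C) (b : ℝ) :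
    HasDerivAt (fun s => ∫ U, F U ∂(ν s)) (-cov[F, fun U => ∑ A ∈ T, V A U; ν b]) b := by
  haveI := (show IsGibbsMeasure _ μ from hμ).isProbabilityMeasure
  have hνs : ∀ s, ν s = μ.tilted fun U => -s * ∑ A ∈ T, V A U := fun s => by
    have h := hν s
    rw [perturbedGibbsMeasures_add_smul_eq_singleton ρ hρ β hW hWb hsupp hV hVb hsuppV hT huniq hμ s] at h
    exact h
  choose CV hCV using hVb
  have hHm : Measurable fun U : LGConfig d G => ∑ A ∈ T, V A U := Finset.measurable_sum _ fun A _ => (hV A).2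
  have hHb : ∀ U : LGConfig d G, |∑ A ∈ T, V A U| ≤ ∑ A ∈ T, CV A := fun U =>
    (Finset.abs_sum_le_sum_abs _ _).trans (Finset.sum_le_sum fun A _ => hCV A U)
  have key := hasDerivAt_integral_tilted_of_bounded (μ := μ) hHm hHb hFm.aestronglyMeasurable hFb b
  have hfun : (fun s => ∫ U, F U ∂(ν s)) = fun s : ℝ => ∫ U, F U ∂(μ.tilted fun U => -s * ∑ A ∈ T, V A U) :=
    funext fun s => by rw [hνs s]
  rw [hfun, hνs b]
  exact key

/-- **THE STATIC SUSCEPTIBILITY IS MINUS THE UNPERTURBED COVARIANCE**: at `s = 0` the selection IS the member's state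
(`ν 0 = μ`) and `d/ds|_{s=0} ∫ F dν_s = −cov_μ(F, H^V)`. -/
theorem hasDerivAt_integral_at_member (hρ : Continuous ρ) (β : ℝ)
    {W : Potential (ZdEdge d) G} (hW : W.IsAdapted) (hWb : ∀ X, ∃ C, ∀ U, |W X U| ≤ C)
    {supp : Finset (ZdEdge d) → Finset (Finset (ZdEdge d))} (hsupp : W.IsSupportedBy supp)
    {V : Potential (ZdEdge d) G} (hV : V.IsAdapted) (hVb : ∀ X, ∃ C, ∀ U, |V X U| ≤ C)
    {suppV : Finset (ZdEdge d) → Finset (Finset (ZdEdge d))} (hsuppV : V.IsSupportedBy suppV)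
    {T : Finset (Finset (ZdEdge d))} (hT : ∀ Λ, suppV Λ ⊆ T)
    (huniq : (perturbedGibbsMeasures ρ β W supp).Subsingleton)
    {μ : Measure (LGConfig d G)} (hμ : μ ∈ perturbedGibbsMeasures ρ β W supp)
    {ν : ℝ → Measure (LGConfig d G)} (hν : ∀ s, ν s ∈ perturbedGibbsMeasures ρ β (W + s • V) (fun Λ => supp Λ ∪ suppV Λ))
    {F : LGConfig d G → ℝ} (hFm : Measurable F) {C : ℝ} (hFb : ∀ U, |F U| ≤ C) :
    ν 0 = μ ∧ HasDerivAt (fun s => ∫ U, F U ∂(ν s)) (-cov[F, fun U => ∑ A ∈ T, V A U; μ]) 0 := by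
  haveI := (show IsGibbsMeasure _ μ from hμ).isProbabilityMeasure
  have h0 : ν 0 = μ := by
    have h := hν 0
    rw [perturbedGibbsMeasures_add_smul_eq_singleton ρ hρ β hW hWb hsupp hV hVb hsuppV hT huniq hμ 0] at h
    rw [Set.mem_singleton_iff.1 h]
    simp only [neg_zero, zero_mul]
    exact tilted_const μ 0
  have key := hasDerivAt_integral_of_mem_perturbedGibbsMeasures_add_smul ρ hρ β hW hWb hsupp hV hVb hsuppV hT huniq hμ hν
    hFm hFb 0
  rw [h0] at key
  exact ⟨h0, key⟩

end General

/-! ### Tier 2: the same on the weighted (infinite-range) ball -/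

section TierTwo

variable {G : Type*} [Group G] [TopologicalSpace G] [IsTopologicalGroup G] [CompactSpace G]
  [MeasurableSpace G] [BorelSpace G] [SecondCountableTopology G] [T2Space G] (ρ : G →* Matrix (Fin N) (Fin N) ℂ)

/-- **TIER 2 — FOR EVERY REAL `s`, `W + s·V` HAS EXACTLY THE ONE DLR STATE `μ.tilted (−s H^V)`** (link-summable `W` with
continuous own-link terms and at most one DLR state `μ`; source `V` with continuous own-link terms listed by `suppV ⊆ T`). -/
theorem perturbedGibbsMeasuresS_add_smul_eq_singleton (hρ : Continuous ρ) (β : ℝ)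
    {W : Potential (ZdEdge d) G} {B : Finset (ZdEdge d) → ℝ} (hW : IsLinkSummable W B) (hWc : ∀ X, Continuous (W X))
    (hWdep : ∀ X, DependsOn (W X) (↑X : Set (ZdEdge d)))
    {V : Potential (ZdEdge d) G} (hVc : ∀ X, Continuous (V X)) (hVdep : ∀ X, DependsOn (V X) (↑X : Set (ZdEdge d)))
    {suppV : Finset (ZdEdge d) → Finset (Finset (ZdEdge d))} (hsuppV : V.IsSupportedBy suppV)
    {T : Finset (Finset (ZdEdge d))} (hT : ∀ Λ, suppV Λ ⊆ T)
    (huniq : (perturbedGibbsMeasuresS ρ β W).Subsingleton)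
    {μ : Measure (LGConfig d G)} (hμ : μ ∈ perturbedGibbsMeasuresS ρ β W) (s : ℝ) :
    perturbedGibbsMeasuresS ρ β (W + s • V) = {μ.tilted fun U => -s * ∑ A ∈ T, V A U} := by
  have hVa : V.IsAdapted := fun X => ⟨hVdep X, (hVc X).measurable⟩
  have hVb : ∀ X, ∃ C, ∀ U, |V X U| ≤ C := fun X => exists_bound_of_continuous (hVc X)
  obtain ⟨-, -, hsVsupp⟩ := smul_source_data hVa hVb hsuppV s
  have hsVc : ∀ X, Continuous ((s • V) X) := fun X => (hVc X).const_smul s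
  have hsVdep : ∀ X, DependsOn ((s • V) X) (↑X : Set (ZdEdge d)) := fun X U U' h => by
    simp only [Pi.smul_apply, smul_eq_mul]
    rw [hVdep X h]
  have hset : perturbedGibbsMeasuresS ρ β W = {μ} :=
    Set.eq_singleton_iff_unique_mem.2 ⟨hμ, fun ν hν => huniq hν hμ⟩
  rw [perturbedGibbsMeasuresS_add_eq_image ρ hρ β hW hWc hWdep hsVc hsVdep hsVsupp hT, hset, Set.image_singleton]
  congr 1
  congr 1
  funext U
  exact sum_smul_source V T s U

/-- **TIER 2 — FEYNMAN–HELLMANN**: for every selection `ν s ∈ 𝒢_S(W + s·V)` and every bounded measurable `F`,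
`d/ds ∫ F dν_s |_{s=b} = −cov_{ν_b}(F, H^V)` at every real `b`; and `ν 0 = μ`. -/
theorem hasDerivAt_integral_of_mem_perturbedGibbsMeasuresS_add_smul (hρ : Continuous ρ) (β : ℝ)
    {W : Potential (ZdEdge d) G} {B : Finset (ZdEdge d) → ℝ} (hW : IsLinkSummable W B) (hWc : ∀ X, Continuous (W X))
    (hWdep : ∀ X, DependsOn (W X) (↑X : Set (ZdEdge d)))
    {V : Potential (ZdEdge d) G} (hVc : ∀ X, Continuous (V X)) (hVdep : ∀ X, DependsOn (V X) (↑X : Set (ZdEdge d)))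
    {suppV : Finset (ZdEdge d) → Finset (Finset (ZdEdge d))} (hsuppV : V.IsSupportedBy suppV)
    {T : Finset (Finset (ZdEdge d))} (hT : ∀ Λ, suppV Λ ⊆ T)
    (huniq : (perturbedGibbsMeasuresS ρ β W).Subsingleton)
    {μ : Measure (LGConfig d G)} (hμ : μ ∈ perturbedGibbsMeasuresS ρ β W)
    {ν : ℝ → Measure (LGConfig d G)} (hν : ∀ s, ν s ∈ perturbedGibbsMeasuresS ρ β (W + s • V))
    {F : LGConfig d G → ℝ} (hFm : Measurable F) {C : ℝ} (hFb : ∀ U, |F U| ≤ C) (b : ℝ) :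
    ν 0 = μ ∧ HasDerivAt (fun s => ∫ U, F U ∂(ν s)) (-cov[F, fun U => ∑ A ∈ T, V A U; ν b]) b := by
  haveI := (show IsGibbsMeasure _ μ from hμ).isProbabilityMeasure
  have hνs : ∀ s, ν s = μ.tilted fun U => -s * ∑ A ∈ T, V A U := fun s => by
    have h := hν s
    rw [perturbedGibbsMeasuresS_add_smul_eq_singleton ρ hρ β hW hWc hWdep hVc hVdep hsuppV hT huniq hμ s] at h
    exact h
  choose CV hCV using fun X => exists_bound_of_continuous (hVc X)
  have hHm : Measurable fun U : LGConfig d G => ∑ A ∈ T, V A U := Finset.measurable_sum _ fun A _ => (hVc A).measurable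
  have hHb : ∀ U : LGConfig d G, |∑ A ∈ T, V A U| ≤ ∑ A ∈ T, CV A := fun U =>
    (Finset.abs_sum_le_sum_abs _ _).trans (Finset.sum_le_sum fun A _ => hCV A U)
  have key := hasDerivAt_integral_tilted_of_bounded (μ := μ) hHm hHb hFm.aestronglyMeasurable hFb b
  have hfun : (fun s => ∫ U, F U ∂(ν s)) = fun s : ℝ => ∫ U, F U ∂(μ.tilted fun U => -s * ∑ A ∈ T, V A U) :=
    funext fun s => by rw [hνs s]
  refine ⟨?_, ?_⟩
  · rw [hνs 0]
    simp only [neg_zero, zero_mul]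
    exact tilted_const μ 0
  · rw [hfun, hνs b]
    exact key

end TierTwo

end Summit.Ventures.YMGap.RobustBall

end
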